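/-
COR-CM (cell pub-hodgecm2, stage 2 of the Hodge ladder) — count-neutral KERNEL COMBINATORICS «order 16: the quaternion doublings `Q₈ × ℤ/2` and
`Q₈ ∘ ℤ/4` (Pauli)», part VI: the ENGINE, I — certified face sums lie in the family module; representatives; the core read on labels
(seat prover-pub-hodgecm2-b23-g54-0, binder prover b23, gen 54; claim HOME/INBOX.md l.25095).  Bookkeeping definitions with bodies (`T`, `absF`, `absSrc`,
`famFin`, `N`, `repLab`, `rep`) + theorems on parts I–IV and seat b23 gen 41/46/47ʼs split index-two files BY NAME; no `decide` beyond closed identities in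
`ZMod 2`/`Fin 4`/`Fin 8`, no certificate, no named fact, no `sorry`.  `Interfaces.lean` (C1), every E term, B01, `Transposition/*`, `PortJoin/*`,
`D2Bridge/*` untouched.
HONEST FRAMING: `HC_CM` is NOT proved, here or anywhere in the tree; nothing here is a period, a count of record or a headline.
T5: n/a-class (hypothesis binders = the fields of `QuaternionDoubling.Datum` and `Plan.Valid`); checker: self.
-/
import Summits.HodgeConjecture.CorCM.Census.QuaternionDoublingDictionary
import Summits.HodgeConjecture.CorCM.Census.QuaternionDoublingPlan
import Summits.HodgeConjecture.CorCM.Census.SpectatorSquares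

/-!
# The quaternion doublings, VI: the engine, I

Along a datum `D : Datum G c τ` and a plan `P`:
* §0 **Transport of vectors** `T = (ty)_* : ℤ[CMF G c] → ℤ[labels]` (injective, linear): faces go to model faces, pairs to model pairs, base changes
  along `wordG w` to `Motw τ w` (`T_gface_word`, `T_pair`, `T_mapDomain_rt_wordG`).
* §1 **Abstract faces of the plan**: `absF (Θ, p, q) = gface (typeOf Θ) (word 0 p) (word 0 q)`, signed sums `absSrc`, the family `famFin` and its
  module `N = ℤ⟨pairs⟩ + ℤ[G]·famFin`; transport: `T (absSrc s) = srcVal s`.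
* §2 **CERTIFIED SUMS LIE IN `N`** (`absSrc_mem_of_cancels`): if the sources of a certificate lie in `N` and its coded list cancels (part I), so does the
  target — the transport `T` is injective and carries base changes along `wordG w` to `Motw τ w` and pairs to model pairs (part III); hence every
  face sum available in a VALID plan lies in `N` (`absSrc_mem_of_avail`).
* §3 **Representatives**: `rep b = typeOf (repLab (ty b.out))` is a listed representative of the block `b` (`blk_rep`, `rep_eq`).
* §4 **The core on labels**: elements of `H` are the words `word e u` (`u < 4`); `x · word e u = word (e + twist τ u) (u + 4)`; membership in
  `res₀ Ψ` / `res₁ Ψ` reads `ty Ψ u = e` / `ty Ψ (u+4) = e + twist τ u`; the DISTANCE IS THE MODEL DISTANCE: `wt (res₁ Ψ) (res₀ Ψ) = Dst τ (ty Ψ)`.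
All [folklore] bookkeeping over [Pohlmann1968, Thm 1].

## References
* [Pohlmann1968] H. Pohlmann, Algebraic cycles on abelian varieties of complex multiplication type, Ann. of Math. 88 (1968), Thm 1.
-/

namespace Summit.HodgeConjecture.CorCM.Census.QuaternionDoubling

open Finset
open Summit.HodgeConjecture.CorCM.Prior.AllgGroup.RfwfAllgGroup
open Summit.HodgeConjecture.CorCM.Census.BlockParity
open Summit.HodgeConjecture.CorCM.Census.Coinvariant
open Summit.HodgeConjecture.CorCM.Census.ComplementFaces
open Summit.HodgeConjecture.CorCM.Census.IndexTwoDescent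

noncomputable section

variable {G : Type*} [Group G] [Fintype G] [DecidableEq G] {c : G} {τ : ZMod 2} (D : Datum G c τ) (P : Plan)

/-! ## §0 Transport of vectors -/

/-- **The transport** `T = (ty)_* : ℤ[CMF G c] → ℤ[labels]`. [folklore] -/
def T : (CMF G c →₀ ℤ) →ₗ[ℤ] (Lab →₀ ℤ) := Finsupp.lmapDomain ℤ ℤ (ty D)

/-- `T [Ψ] = [ty Ψ]`. [folklore] -/
@[simp] theorem T_single (Ψ : CMF G c) (n : ℤ) : T D (Finsupp.single Ψ n) = Finsupp.single (ty D Ψ) n := by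
  simp [T, Finsupp.lmapDomain_apply, Finsupp.mapDomain_single]

/-- `T` is injective. [folklore] -/
theorem T_injective : Function.Injective (T (c := c) D) := fun y z h =>
  Finsupp.mapDomain_injective (ty_injective D) (by simpa [T, Finsupp.lmapDomain_apply] using h)

/-- **Faces go to model faces**: `T (gface (typeOf Θ) (word e p) (word e' q)) = mface Θ p q`. [folklore] -/
theorem T_gface_word (Θ : Lab) (e e' : ZMod 2) (p q : Fin 8) :
    T D (gface c D.c_mul_c (typeOf D Θ) (word D e p) (word D e' q)) = mface Θ p q := by
  simp only [gface, map_add, map_sub, T_single, ty_oflipCM_word, ty_typeOf, mface]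

/-- **Pairs go to model pairs**: `T (pair (typeOf Θ)) = mpair Θ`. [folklore] -/
theorem T_pair (Θ : Lab) : T D (pair c (typeOf D Θ)) = mpair Θ := by
  simp only [pair, map_add, T_single, ty_rt_c, ty_typeOf, mpair]

/-- **Base changes go to word motions**: `T (y·(wordG w)⁻¹) = (Motw τ w)_* (T y)`. [folklore] -/
theorem T_mapDomain_rt_wordG (w : Fin 16) (y : CMF G c →₀ ℤ) :
    T D (Finsupp.mapDomain (rt c (wordG D w)) y) = Finsupp.mapDomain (Motw τ w) (T D y) := by
  simp only [T, Finsupp.lmapDomain_apply, ← Finsupp.mapDomain_comp]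
  congr 1
  funext Ψ
  exact ty_rt_wordG D w Ψ


/-! ## §1 Abstract faces of the plan -/

/-- **The abstract face** of a model face `(Θ, p, q)`. [folklore] -/
def absF (f : Lab × Fin 8 × Fin 8) : CMF G c →₀ ℤ := gface c D.c_mul_c (typeOf D f.1) (word D 0 f.2.1) (word D 0 f.2.2)

/-- **The abstract value** of a signed face sum. [folklore] -/
def absSrc (s : Src) : CMF G c →₀ ℤ := (s.map fun e => e.2 • absF D e.1).sum

/-- **The abstract face family** of a plan. [folklore] -/
def famFin : Finset (CMF G c →₀ ℤ) := (P.fam.map (absF D)).toFinset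

/-- **The family module** `N = ℤ⟨pairs⟩ + ℤ[G]·famFin`. [folklore] -/
def N : Submodule ℤ (CMF G c →₀ ℤ) := Submodule.span ℤ (pairSet c) ⊔ Submodule.span ℤ (translates c (famFin D P))

/-- Faces with any exponents at the two words are the abstract face. [folklore] -/
theorem gface_word_word (Θ : Lab) (e e' : ZMod 2) (p q : Fin 8) :
    gface c D.c_mul_c (typeOf D Θ) (word D e p) (word D e' q) = absF D (Θ, p, q) :=
  T_injective D (by rw [absF, T_gface_word, T_gface_word])

/-- `T (absF f) = mface`. [folklore] -/
theorem T_absF (f : Lab × Fin 8 × Fin 8) : T D (absF D f) = mface f.1 f.2.1 f.2.2 := T_gface_word D _ _ _ _ _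

/-- **`T (absSrc s) = srcVal s`.** [folklore] -/
theorem T_absSrc (s : Src) : T D (absSrc D s) = srcVal s := by
  induction s with
  | nil => simp [absSrc, srcVal]
  | cons e s ih =>
    rw [absSrc, List.map_cons, List.sum_cons, ← absSrc, map_add, map_zsmul, ih, T_absF, srcVal_cons]

/-- `absSrc` of a cons. [folklore] -/
theorem absSrc_cons (e : (Lab × Fin 8 × Fin 8) × ℤ) (s : Src) : absSrc D (e :: s) = e.2 • absF D e.1 + absSrc D s := rfl

/-- A one-term sum is the face. [folklore] -/
theorem absSrc_singleton (f : Lab × Fin 8 × Fin 8) : absSrc D [(f, 1)] = absF D f := by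
  simp [absSrc]

/-- An abstract face with distinct places is a face. [folklore] -/
theorem absF_mem_gfaceSet {f : Lab × Fin 8 × Fin 8} (hf : f.2.1 ≠ f.2.2) : absF D f ∈ gfaceSet G c D.c_mul_c :=
  ⟨typeOf D f.1, word D 0 f.2.1, word D 0 f.2.2, fun h => hf ((word_mem_orb_word_iff D 0 0 f.2.1 f.2.2).mp h).symm, rfl⟩

/-- In a valid plan the family consists of faces. [folklore] -/
theorem famFin_subset (hV : P.Valid τ = true) : ((famFin D P : Finset _) : Set (CMF G c →₀ ℤ)) ⊆ gfaceSet G c D.c_mul_c := by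
  intro y hy
  obtain ⟨f, hf, rfl⟩ := List.mem_map.mp (List.mem_toFinset.mp (Finset.mem_coe.mp hy))
  exact absF_mem_gfaceSet D (Plan.fam_ne hV hf)

/-- `N` is base-change stable. [folklore] -/
theorem N_rt (Q : G) {y : CMF G c →₀ ℤ} (hy : y ∈ N D P) : Finsupp.mapDomain (rt c Q) y ∈ N D P :=
  TwistGeneration.mapDomain_rt_mem_psp c (Subgroup.mem_center_iff.mp D.c_mem_center) Q _ hy

/-- `N` contains the pairs. [folklore] -/
theorem pair_mem_N (Ψ : CMF G c) : pair c Ψ ∈ N D P := Submodule.mem_sup_left (Submodule.subset_span (pair_mem_pairSet c Ψ))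

/-- `N` lies in the Hodge lattice (valid plan). [folklore] -/
theorem N_le_hodgeSpan (hV : P.Valid τ = true) : N D P ≤ hodgeSpan c D.c_mul_c :=
  sup_le le_sup_right (IndexTwoDescent.span_translates_le_hodgeSpan D.c_mul_c _ (famFin_subset D P hV))

/-- Family faces lie in `N`. [folklore] -/
theorem absF_mem_N {f : Lab × Fin 8 × Fin 8} (hf : f ∈ P.fam) : absF D f ∈ N D P :=
  Submodule.mem_sup_right (TwistGeneration.mem_span_translates_of_mem c _ (List.mem_toFinset.mpr (List.mem_map.mpr ⟨f, hf, rfl⟩)))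

/-- `famFin` has at most `|fam|` members. [folklore] -/
theorem card_famFin_le : (famFin D P).card ≤ P.fam.length :=
  (List.toFinset_card_le _).trans (by rw [List.length_map])

/-! ## §2 Certified sums lie in `N` -/

/-- **CERTIFIED SUMS LIE IN `N`.** [folklore] -/
theorem absSrc_mem_of_cancels (tgt : Src) (C : Cert) (hsrc : ∀ e ∈ C.1, absSrc D e.1 ∈ N D P)
    (hc : cancels ((certList τ tgt C).map fun p => (code p.1, p.2)) = true) : absSrc D tgt ∈ N D P := by
  set Z : CMF G c →₀ ℤ := (C.1.map fun e => e.2.2 • Finsupp.mapDomain (rt c (wordG D e.2.1)) (absSrc D e.1)).sum +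
    (C.2.map fun p => p.2 • pair c (typeOf D p.1)).sum with hZ
  have hZN : Z ∈ N D P := by
    refine Submodule.add_mem _ (list_sum_mem fun y hy => ?_) (list_sum_mem fun y hy => ?_)
    · obtain ⟨e, he, rfl⟩ := List.mem_map.mp hy
      exact Submodule.smul_mem _ _ (N_rt D P _ (hsrc e he))
    · obtain ⟨p, -, rfl⟩ := List.mem_map.mp hy
      exact Submodule.smul_mem _ _ (pair_mem_N D P _)
  have hT : T D (absSrc D tgt) = T D Z := by
    rw [T_absSrc, srcVal_eq_of_cancels τ tgt C hc, hZ, map_add, map_list_sum, map_list_sum, List.map_map, List.map_map]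
    congr 1
    · congr 1
      refine List.map_congr_left fun e _ => ?_
      simp only [Function.comp, map_zsmul, T_mapDomain_rt_wordG, T_absSrc]
    · congr 1
      refine List.map_congr_left fun p _ => ?_
      simp only [Function.comp, map_zsmul, T_pair]
  rw [T_injective D hT]
  exact hZN

/-- **Every available face sum of a valid plan lies in `N`.** [folklore] -/
theorem absSrc_mem_of_avail (hV : P.Valid τ = true) {s : Src} (hs : s ∈ P.avail) : absSrc D s ∈ N D P :=
  Plan.avail_spec hV (M := fun s => absSrc D s ∈ N D P) (fun f hf => by rw [absSrc_singleton]; exact absF_mem_N D P hf)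
    (fun tgt C hsrc hc => absSrc_mem_of_cancels D P tgt C hsrc hc) hs

/-! ## §3 Representatives -/

/-- The representative label of a label (through the transporter table). [folklore] -/
def repLab (Θ : Lab) : Lab := P.rep (P.trOf Θ).2

/-- **The representative of a block.** [folklore] -/
def rep (b : Block c) : CMF G c := typeOf D (repLab P (ty D b.out))

/-- The representative label is the word motion of the label. [folklore] -/
theorem repLab_eq (hV : P.Valid τ = true) (Θ : Lab) : Motw τ (P.trOf Θ).1 Θ = repLab P Θ := (Plan.tr_spec hV Θ).2.1

/-- **`rep b` lies in `b`.** [folklore] -/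
theorem blk_rep (hV : P.Valid τ = true) (b : Block c) : blk c (rep D P b) = b := by
  rw [rep, ← repLab_eq P hV, typeOf_Motw, typeOf_ty, blk_rt]
  exact Quotient.out_eq b

/-- `rep b` is a listed representative. [folklore] -/
theorem rep_eq (hV : P.Valid τ = true) (b : Block c) : ∃ r, r < P.reps.length ∧ rep D P b = typeOf D (P.rep r) :=
  ⟨(P.trOf (ty D b.out)).2, (Plan.tr_spec hV _).1, rfl⟩

/-- Every type is a base change of a listed representative, along an `H`-word (`< 8`) when the type is diagonal in the model. [folklore] -/
theorem exists_rt_eq_rep (hV : P.Valid τ = true) (Ψ : CMF G c) :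
    ∃ w : Fin 16, ∃ r, r < P.reps.length ∧ rt c (wordG D w) Ψ = typeOf D (P.rep r) ∧ (Dst τ (ty D Ψ) = 0 → w.val < 8) := by
  obtain ⟨h1, h2, h3⟩ := Plan.tr_spec hV (ty D Ψ)
  refine ⟨(P.trOf (ty D Ψ)).1, (P.trOf (ty D Ψ)).2, h1, ?_, h3⟩
  rw [← h2, typeOf_Motw, typeOf_ty]

include D in
/-- **The representatives inject into the blocks**: `|reps| ≤ β(G, c)`. [folklore] -/
theorem reps_length_le_card_block (hV : P.Valid τ = true) : P.reps.length ≤ Fintype.card (Block c) := by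
  classical
  let f : Fin P.reps.length → Block c := fun r => blk c (typeOf D (P.rep r))
  have hinj : Function.Injective f := by
    intro a b hab
    obtain ⟨Q, hQ⟩ := exists_rt_eq_of_blk_eq c hab
    -- `Q` is a word `wordG w`
    obtain ⟨u, hu, v, hv, d, hd, rfl⟩ := D.exhaust Q
    obtain ⟨e, q, he, hq, rfl⟩ : ∃ e q : ℕ, e < 2 ∧ q < 2 ∧ u = 2 * e + q := ⟨u / 2, u % 2, by omega, by omega, by omega⟩
    obtain ⟨w, hw⟩ : ∃ w : Fin 16, D.i ^ (2 * e + q) * D.j ^ v * D.x ^ d = wordG D w := by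
      refine ⟨⟨e + 2 * q + 4 * v + 8 * d, by omega⟩, ?_⟩
      simp only [wordG]
      have e1 : (e + 2 * q + 4 * v + 8 * d) % 2 = e := by omega
      have e2 : (e + 2 * q + 4 * v + 8 * d) / 2 % 2 = q := by omega
      have e3 : (e + 2 * q + 4 * v + 8 * d) / 4 % 2 = v := by omega
      have e4 : (e + 2 * q + 4 * v + 8 * d) / 8 % 2 = d := by omega
      rw [e1, e2, e3, e4, pow_add, pow_mul, pow_two, D.hii]
    rw [hw] at hQ
    have hty := congrArg (ty D) hQ
    rw [ty_rt_wordG, ty_typeOf, ty_typeOf] at hty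
    exact Fin.ext (Plan.inequiv hV a.2 b.2 w hty)
  simpa using Fintype.card_le_of_injective f hinj

/-! ## §4 The core on labels -/

omit [Fintype G] [DecidableEq G] in
/-- `word e u` (`u < 4`) lies in the core. [folklore] -/
theorem word_hp_mem_H (e : ZMod 2) (u : Fin 4) : word D e (hp u) ∈ D.H := by
  unfold word
  refine mul_mem ?_ ?_
  · unfold cpow; split_ifs
    · exact one_mem _
    · exact D.c_mem_H
  · fin_cases u
    · exact one_mem _
    · exact D.i_mem_H
    · exact D.j_mem_H
    · exact mul_mem D.i_mem_H D.j_mem_H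

omit [Fintype G] [DecidableEq G] in
/-- **Every element of the core is a word at a core place.** [folklore] -/
theorem exists_word_hp_of_mem_H {g : G} (hg : g ∈ D.H) : ∃ (e : ZMod 2) (u : Fin 4), g = word D e (hp u) := by
  obtain ⟨a, ha, b, hb, rfl⟩ := (D.mem_H_iff g).mp hg
  have hc1 : cpow c 1 = c := by simp [cpow]
  have hi2 : D.i ^ 2 = c := by rw [pow_two, D.hii]
  have hi3 : D.i ^ 3 = c * D.i := by rw [pow_succ, hi2]
  interval_cases a <;> interval_cases b
  · exact ⟨0, 0, by simp [word, xk, hp, cpow]⟩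
  · exact ⟨0, 2, by simp [word, xk, hp, cpow]⟩
  · exact ⟨0, 1, by simp [word, xk, hp, cpow]⟩
  · exact ⟨0, 3, by simp [word, xk, hp, cpow]⟩
  · exact ⟨1, 0, by simp [word, xk, hp, hc1, hi2]⟩
  · exact ⟨1, 2, by simp [word, xk, hp, hc1, hi2]⟩
  · exact ⟨1, 1, by simp [word, xk, hp, hc1, hi3]⟩
  · exact ⟨1, 3, by simp [word, xk, hp, hc1, hi3, mul_assoc]⟩

omit [Fintype G] [DecidableEq G] in
/-- The group word of an `H`-word code (`< 8`) lies in the core. [folklore] -/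
theorem wordG_mem_H {w : Fin 16} (hw : w.val < 8) : wordG D w ∈ D.H := by
  have h8 : w.val / 8 % 2 = 0 := by omega
  rw [wordG, h8, pow_zero, mul_one]
  exact mul_mem (mul_mem (D.H.pow_mem D.c_mem_H _) (D.H.pow_mem D.i_mem_H _)) (D.H.pow_mem D.j_mem_H _)

omit [DecidableEq G] in
/-- **`x · word e u = word (e + twist τ u) (u + 4)`.** [folklore] -/
theorem x_mul_word_hp (e : ZMod 2) (u : Fin 4) : D.x * word D e (hp u) = word D (e + twist τ u) (xp u) := by
  have key : ∀ u : Fin 4, D.x * xk D (hp u) = cpow c (twist τ u) * xk D (xp u) := by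
    intro u
    fin_cases u
    · show D.x * 1 = cpow c 0 * D.x; simp [cpow]
    · show D.x * D.i = cpow c τ * (D.i * D.x); rw [D.x_mul_i, mul_assoc]
    · show D.x * D.j = cpow c τ * (D.j * D.x); rw [D.x_mul_j, mul_assoc]
    · show D.x * (D.i * D.j) = cpow c 0 * (D.i * D.j * D.x); rw [D.x_mul_ij]; simp [cpow]
  unfold word
  rw [← mul_assoc, ← cpow_comm D e D.x, mul_assoc, key, ← mul_assoc, cpow_mul_cpow' D]

variable [DecidablePred (· ∈ D.H)]

/-- **Membership of a core word in `res₀ Ψ`** reads the label at `u`. [folklore] -/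
theorem word_mem_res₀_iff (Ψ : CMF G c) (e : ZMod 2) (u : Fin 4) :
    (⟨word D e (hp u), word_hp_mem_H D e u⟩ : D.H) ∈ (res₀ D.c_mem_H Ψ).1 ↔ ty D Ψ (hp u) = e := by
  rw [mem_res₀]; exact word_mem_iff D Ψ e (hp u)

/-- **Membership of a core word in `res₁ Ψ`** reads the label at `u + 4`, twisted. [folklore] -/
theorem word_mem_res₁_iff (Ψ : CMF G c) (e : ZMod 2) (u : Fin 4) :
    (⟨word D e (hp u), word_hp_mem_H D e u⟩ : D.H) ∈ (res₁ D.c_mem_H (Subgroup.mem_center_iff.mp D.c_mem_center) D.x Ψ).1 ↔ ty D Ψ (xp u) = e + twist τ u := by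
  rw [mem_res₁]
  show D.x * word D e (hp u) ∈ Ψ.1 ↔ _
  rw [x_mul_word_hp, word_mem_iff]

/-- `z + z = 0` in `ℤ/2`. [folklore] -/
private theorem add_self_zmod2 : ∀ z : ZMod 2, z + z = 0 := by decide

/-- **A core word is a deviation of `Ψ` iff its place is mismatched in the label and its exponent is `ty Ψ (u+4) + twist τ u`.** [folklore] -/
theorem word_dev_iff (Ψ : CMF G c) (e : ZMod 2) (u : Fin 4) :
    ((⟨word D e (hp u), word_hp_mem_H D e u⟩ : D.H) ∈ (res₁ D.c_mem_H (Subgroup.mem_center_iff.mp D.c_mem_center) D.x Ψ).1 ∧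
      (⟨word D e (hp u), word_hp_mem_H D e u⟩ : D.H) ∉ (res₀ D.c_mem_H Ψ).1) ↔
      (u ∈ devSet τ (ty D Ψ) ∧ e = ty D Ψ (xp u) + twist τ u) := by
  rw [word_mem_res₁_iff, word_mem_res₀_iff, devSet, mem_filter]
  have key : ∀ a b t e : ZMod 2, (b = e + t ∧ ¬ a = e) ↔ ((¬ a = b + t) ∧ e = b + t) := by decide
  simpa using key (ty D Ψ (hp u)) (ty D Ψ (xp u)) (twist τ u) e

/-- **THE DISTANCE IS THE MODEL DISTANCE**: `wt (res₁ Ψ) (res₀ Ψ) = Dst τ (ty Ψ)`. [folklore] -/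
theorem wt_res_eq_Dst (Ψ : CMF G c) :
    wt (⟨c, D.c_mem_H⟩ : D.H) (res₁ D.c_mem_H (Subgroup.mem_center_iff.mp D.c_mem_center) D.x Ψ) (res₀ D.c_mem_H Ψ) = Dst τ (ty D Ψ) := by
  classical
  unfold wt Dst
  -- the deviation elements are the words `word (ty Ψ (u+4) + twist u) u`, `u` mismatched
  let f : Fin 4 → D.H := fun u => ⟨word D (ty D Ψ (xp u) + twist τ u) (hp u), word_hp_mem_H D _ u⟩
  have hf : Function.Injective f := by
    intro u u' h
    have := congrArg Subtype.val h
    exact Fin.castLE_injective _ ((word_eq_word_iff D _ _ _ _).mp this).2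
  have himage : (res₁ D.c_mem_H (Subgroup.mem_center_iff.mp D.c_mem_center) D.x Ψ).1 \ (res₀ D.c_mem_H Ψ).1 = (devSet τ (ty D Ψ)).image f := by
    ext h
    rw [mem_sdiff, mem_image]
    constructor
    · rintro ⟨h1, h0⟩
      obtain ⟨e, u, he⟩ := exists_word_hp_of_mem_H D h.2
      have hh : h = ⟨word D e (hp u), word_hp_mem_H D e u⟩ := Subtype.ext he
      subst hh
      obtain ⟨hu, rfl⟩ := (word_dev_iff D Ψ e u).mp ⟨h1, h0⟩
      exact ⟨u, hu, rfl⟩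
    · rintro ⟨u, hu, rfl⟩
      exact (word_dev_iff D Ψ _ u).mpr ⟨hu, rfl⟩
  rw [himage, card_image_of_injective _ hf]

/-- The model distance read on `rep`: `wt` of a listed representative's type is `Dst` of its label. [folklore] -/
theorem wt_typeOf (Θ : Lab) : wt (⟨c, D.c_mem_H⟩ : D.H) (res₁ D.c_mem_H (Subgroup.mem_center_iff.mp D.c_mem_center) D.x (typeOf D Θ)) (res₀ D.c_mem_H (typeOf D Θ)) = Dst τ Θ := by
  rw [wt_res_eq_Dst, ty_typeOf]

end

end Summit.HodgeConjecture.CorCM.Census.QuaternionDoubling
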